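import Literature.Probability.RandomPlanarGeometry.SAWWordAutomata
import HarnessLib

/-!
# Weighted counting of words that survive a pruning automaton (tilted Collatz–Wielandt bound)

Topic `Literature/Probability/RandomPlanarGeometry` (continues `SAWWordAutomata.lean`). The
letter-WEIGHTED form of the Collatz–Wielandt counting lemma behind the finite-memory bounds
(Pönitz–Tittmann 2000, §3; Alm 1993): each letter `d` carries a weight `W d ∈ ℕ`, a word `w` the
weight `Π_i W(w_i)`; if `R ∋ []` is closed under the transitions of the automaton `step` and
`v ≥ 1` on `R` satisfies the weighted sub-invariance `D · Σ_d W(d) · v(step a d) ≤ N · v(a)` on `R`,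
then the total weight of the surviving words of length `n` is at most `(N/D)ⁿ · v([])`
(`sum_liveWords_wprod_mul_pow_le`). With `W ≡ 1` this is `card_liveWords_mul_pow_le`. The
weighted form is the exponential-tilting (Chernoff) device: for `W(±e₀) ≈ e^{±θ}`, `W(±e₁) = 1` it
bounds `Σ_{SAW} e^{θ x(ω_n)}` by the Perron root of the tilted automaton, hence the number of
`n`-step self-avoiding walks with `x(ω_n) ≥ vn` by `e^{-θvn}` times it (`SAWTiltedFiniteMemory.lean`).

## Contents (namespace `Literature.Probability.RandomPlanarGeometry.SAW.WordAutomaton`)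

* `wprod W w = Π_i W(w_i)`; `CertificateW step R v W N D`; `weightSumW`;
* `mul_weightSumW_succ_le` (`D Φₙ₊₁ ≤ N Φₙ`), `pow_mul_weightSumW_le` (`Dⁿ Φₙ ≤ Nⁿ v([])`),
  **`sum_liveWords_wprod_mul_pow_le`**: `(Σ_{w live, |w|=n} Π W(w_i)) · Dⁿ ≤ Nⁿ · v([])`,
  **`sum_sawWords_wprod_mul_pow_le`**: the same over the self-avoiding words when they all survive.

## References

* A. Pönitz, P. Tittmann, *Improved upper bounds for self-avoiding walks in ℤᵈ*, Electron. J.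
  Combin. 7 (2000) R21, §3 [PonitzTittmann2000].
* J. M. Hammersley, D. J. A. Welsh / N. Madras, G. Slade, *The Self-Avoiding Walk* (1993), §1.2
  (submultiplicativity), for the counting context [MadrasSlade1993].
-/

open Finset
open scoped BigOperators

namespace Literature.Probability.RandomPlanarGeometry.SAW

namespace WordAutomaton

variable (step : List Step → Step → Option (List Step))

/-- The weight of a word: the product of its letter weights. [cite: PonitzTittmann2000, §3] -/
def wprod (W : Step → ℕ) (w : List Step) : ℕ := (w.map W).prod

/-- `wprod` of the empty word. [cite: PonitzTittmann2000, §3] -/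
@[simp] theorem wprod_nil (W : Step → ℕ) : wprod W [] = 1 := rfl

/-- `wprod` of a word with one more letter. [cite: PonitzTittmann2000, §3] -/
@[simp] theorem wprod_append_singleton (W : Step → ℕ) (w : List Step) (d : Step) :
    wprod W (w ++ [d]) = wprod W w * W d := by
  simp [wprod, List.map_append, List.prod_append]

/-- `wprod` of a `cons`. [cite: PonitzTittmann2000, §3] -/
@[simp] theorem wprod_cons (W : Step → ℕ) (d : Step) (w : List Step) :
    wprod W (d :: w) = W d * wprod W w := by
  simp [wprod]

/-- A **weighted Collatz–Wielandt certificate** for the automaton `step` with letter weights `W`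
and ratio `N/D`: a set of states `R ∋ []` closed under the transitions and a weight `v ≥ 1` on `R`
with `D · Σ_d W(d) · v(step a d) ≤ N · v a` for `a ∈ R`. [cite: PonitzTittmann2000, §3] -/
structure CertificateW (R : Set (List Step)) (v : List Step → ℕ) (W : Step → ℕ) (N D : ℕ) : Prop where
  /-- the initial state is in `R` -/
  nil_mem : [] ∈ R
  /-- `R` is closed under the transitions -/
  closed : ∀ a ∈ R, ∀ d b, step a d = some b → b ∈ R
  /-- the weight is positive on `R` -/
  one_le : ∀ a ∈ R, 1 ≤ v a
  /-- weighted sub-invariance of the weight -/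
  subinv : ∀ a ∈ R, D * ∑ d : Step, W d * ((step a d).map v).getD 0 ≤ N * v a

variable {step}

/-- The weighted total `Φₙ = Σ_{|w| = n} Π W(w_i) · v(run w)` of the runs of length `n`.
[cite: PonitzTittmann2000, §3] -/
def weightSumW (step : List Step → Step → Option (List Step)) (v : List Step → ℕ) (W : Step → ℕ)
    (n : ℕ) : ℕ :=
  ∑ w ∈ words n, wprod W w * phi v (run step w)

/-- `Φ₀ = v([])`. [cite: PonitzTittmann2000, §3] -/
theorem weightSumW_zero (v : List Step → ℕ) (W : Step → ℕ) : weightSumW step v W 0 = v [] := by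
  simp [weightSumW, words]

/-- Surviving runs stay in the closed set `R`. [cite: PonitzTittmann2000, §3] -/
theorem CertificateW.run_mem {R : Set (List Step)} {v : List Step → ℕ} {W : Step → ℕ} {N D : ℕ}
    (hc : CertificateW step R v W N D) (w : List Step) {a : List Step} (h : run step w = some a) :
    a ∈ R := by
  induction w using List.reverseRecOn generalizing a with
  | nil => simp only [run_nil, Option.some.injEq] at h; subst h; exact hc.nil_mem
  | append_singleton w d ih =>
    rw [run_append_singleton] at h
    cases hw : run step w with
    | none => simp [hw] at h
    | some a' => rw [hw, Option.bind_some] at h; exact hc.closed a' (ih hw) d a h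

/-- **One step of the weighted count**: `D · Φₙ₊₁ ≤ N · Φₙ`. [cite: PonitzTittmann2000, §3] -/
theorem mul_weightSumW_succ_le {R : Set (List Step)} {v : List Step → ℕ} {W : Step → ℕ} {N D : ℕ}
    (hc : CertificateW step R v W N D) (n : ℕ) :
    D * weightSumW step v W (n + 1) ≤ N * weightSumW step v W n := by
  rw [weightSumW, weightSumW, sum_words_succ, mul_sum, mul_sum]
  refine sum_le_sum fun w _ => ?_
  cases hw : run step w with
  | none => simp [run_append_singleton, hw]
  | some a =>
    have ha : a ∈ R := hc.run_mem w hw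
    simp only [run_append_singleton, hw, Option.bind_some, phi_eq_getD, wprod_append_singleton]
    have := hc.subinv a ha
    calc D * ∑ d : Step, wprod W w * W d * ((step a d).map v).getD 0
        = wprod W w * (D * ∑ d : Step, W d * ((step a d).map v).getD 0) := by
          rw [mul_sum, mul_sum, mul_sum]; exact sum_congr rfl fun d _ => by ring
      _ ≤ wprod W w * (N * v a) := Nat.mul_le_mul_left _ this
      _ = N * (wprod W w * v a) := by ring

/-- **`Dⁿ Φₙ ≤ Nⁿ v([])`**. [cite: PonitzTittmann2000, §3] -/
theorem pow_mul_weightSumW_le {R : Set (List Step)} {v : List Step → ℕ} {W : Step → ℕ} {N D : ℕ}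
    (hc : CertificateW step R v W N D) (n : ℕ) :
    D ^ n * weightSumW step v W n ≤ N ^ n * v [] := by
  induction n with
  | zero => simp [weightSumW_zero]
  | succ n ih =>
    calc D ^ (n + 1) * weightSumW step v W (n + 1)
        = D ^ n * (D * weightSumW step v W (n + 1)) := by ring
      _ ≤ D ^ n * (N * weightSumW step v W n) := Nat.mul_le_mul_left _ (mul_weightSumW_succ_le hc n)
      _ = N * (D ^ n * weightSumW step v W n) := by ring
      _ ≤ N * (N ^ n * v []) := Nat.mul_le_mul_left _ ih
      _ = N ^ (n + 1) * v [] := by ring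

/-- The total weight of the surviving words is at most the weighted count. [cite: PonitzTittmann2000, §3] -/
theorem sum_liveWords_wprod_le_weightSumW {R : Set (List Step)} {v : List Step → ℕ} {W : Step → ℕ}
    {N D : ℕ} (hc : CertificateW step R v W N D) (n : ℕ) :
    ∑ w ∈ liveWords step n, wprod W w ≤ weightSumW step v W n := by
  rw [liveWords, sum_filter, weightSumW]
  refine sum_le_sum fun w _ => ?_
  split_ifs with h
  · cases hw : run step w with
    | none => exact absurd hw h
    | some a =>
      rw [phi_some]
      exact Nat.le_mul_of_pos_right _ (hc.one_le a (hc.run_mem w hw))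
  · exact Nat.zero_le _

/-- **Weighted Collatz–Wielandt bound for the surviving words**:
`(Σ_{w live, |w| = n} Π W(w_i)) · Dⁿ ≤ Nⁿ · v([])`. [cite: PonitzTittmann2000, §3] -/
theorem sum_liveWords_wprod_mul_pow_le {R : Set (List Step)} {v : List Step → ℕ} {W : Step → ℕ}
    {N D : ℕ} (hc : CertificateW step R v W N D) (n : ℕ) :
    (∑ w ∈ liveWords step n, wprod W w) * D ^ n ≤ N ^ n * v [] :=
  calc (∑ w ∈ liveWords step n, wprod W w) * D ^ n ≤ weightSumW step v W n * D ^ n :=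
        Nat.mul_le_mul_right _ (sum_liveWords_wprod_le_weightSumW hc n)
    _ = D ^ n * weightSumW step v W n := mul_comm _ _
    _ ≤ N ^ n * v [] := pow_mul_weightSumW_le hc n

/-- If every self-avoiding word survives, the **tilted self-avoiding count** obeys
`(Σ_{w ∈ sawWords n} Π W(w_i)) · Dⁿ ≤ Nⁿ · v([])`. [cite: PonitzTittmann2000, §3] -/
theorem sum_sawWords_wprod_mul_pow_le {R : Set (List Step)} {v : List Step → ℕ} {W : Step → ℕ}
    {N D : ℕ} (hc : CertificateW step R v W N D) (hsaw : ∀ w, IsSAW w → run step w ≠ none) (n : ℕ) :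
    (∑ w ∈ sawWords n, wprod W w) * D ^ n ≤ N ^ n * v [] := by
  refine le_trans (Nat.mul_le_mul_right _ ?_) (sum_liveWords_wprod_mul_pow_le hc n)
  refine sum_le_sum_of_subset_of_nonneg (fun w hw => ?_) fun _ _ _ => Nat.zero_le _
  rw [mem_sawWords] at hw
  exact (mem_liveWords step).2 ⟨hw.1, hsaw w hw.2⟩

end WordAutomaton

end Literature.Probability.RandomPlanarGeometry.SAW
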